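import Literature.MathematicalPhysics.KineticTheory.HardSphereEulerProofs
import Literature.Barriers.AtomisticToContinuum.HighMomentumCutoff
import Literature.MathematicalPhysics.KineticTheory.LambertianRedrawNondegenerate
import HarnessLib

/-!
# `LambertianEuler` (stmt-AtomisticToContinuum-11854), line `Sketch`, stub `stub_tailsLambda`:
# the energy-budget rung — `TailsLambda` holds at every FIXED `N`, with constant `K^{N+1}`

Sub-goal `lambertFlow_expVelocityMoment_le_pow` of the research-grade stub `stub_tailsLambda`
(`TailsLambda`: `N`-UNIFORM Gaussian velocity moments in expectation along the Lambertian flow,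
pre-shock; skeleton `Cruxes/LambertianEuler/Lines/Sketch.lean`).  This file certifies the part of
`TailsLambda` that the tree's kinematics already pays for: for continuous profiles `a₀, θ₀ > 0`,
`u₀` there are `a > 0` and `K ≥ 1` such that for every `σ ≤ 1/2`, every `N`, every flow `Φ`
(fixing the type of the local Gibbs law `λ_N`) and EVERY time `s`,

  `∫ (N+1)⁻¹ ∑ᵢ exp(a ‖vᵢ(Λ_s(z, ξ))‖²) d(λ_N ⊗ γ^ℕ)(z, ξ) ≤ K^{N+1}`.

So the expectation in `TailsLambda` is finite at each `N`, for all times and without any Euler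
solution or law of large numbers; the whole content of the stub is the `N`-UNIFORMITY of the
constant (the exponential-in-`N` budget `K^{N+1}` is exactly what the relative-entropy method cannot
use: `HighMomentumCutoffBarrier`).

## Proof

Pathwise, `(N+1)⁻¹ ∑ᵢ e^{a xᵢ} ≤ e^{a ∑ⱼ xⱼ}` for nonnegative `xᵢ = ‖vᵢ(Λ_s)‖²` and `a ≥ 0`, the
kinetic energy never increases along `Λ` (`configEnergy_lambertFlow_le`), and
`e^{a ∑ⱼ ‖vⱼ‖²} = ∏ⱼ e^{a‖vⱼ‖²}`; so the integrand is dominated by a function of the datum `z`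
alone and `lintegral_prod_le` + `γ^ℕ(univ) = 1` reduce the claim to the static product bound
`∫ ∏ⱼ e^{a‖vⱼ‖²} dλ_N ≤ K^{N+1}`: given the positions the velocities are INDEPENDENT Gaussians
(`lintegral_localGibbsMeasure`, `velMeasure` is a product measure, Tonelli
`lintegral_fintype_prod_eq_prod'`), each factor bounded by the uniform one-body constant `K` of
`energyBudget_exists_lintegral_exp_gaussMeasure_le` (Fernique + compactness; the argument of file
`…TailsZero`, restated with `K ≥ 1` to keep this file on `Literature` imports).

References: H. Spohn, *Large Scale Dynamics of Interacting Particles* (1991), Part I §2.3;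
X. Fernique, C. R. Acad. Sci. Paris 270 (1970); B. Nachtergaele, H.-T. Yau, Comm. Math. Phys.
243 (2003), §2.3 Assumption II.1.
-/

noncomputable section

open scoped BigOperators Topology ENNReal InnerProductSpace
open MeasureTheory ProbabilityTheory Filter Set
open Literature.MathematicalPhysics.KineticTheory
open Literature.Analysis.FluidPDE

namespace Summit.AtomisticToContinuum.HydrodynamicLimit.Theorems.LambertianContactSwapLambertianEulerEnergyBudget

-- transfer argument adapted from Theorems/OneFlightGossipEngineEnergyCurrentTailsLevelCensusStatics.lean
-- (same proof as `tailsZero_exists_lintegral_exp_gaussMeasure_le` of …TailsZero, constant normalised to `K ≥ 1`)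
/-- **Uniform one-body Gaussian exponential moment (Fernique + compactness of `𝕋³`).**  For
continuous `θ₀ > 0` and `u₀` there are `a > 0` and `K ≥ 1` with
`∫ e^{a‖v‖²} dN(u₀(x), θ₀(x) id) ≤ K` for every `x ∈ 𝕋³`: Fernique's theorem
(`IsGaussian.exists_integrable_exp_sq`) gives `c > 0` with `e^{c‖w‖²}` integrable for the
standard Gaussian on `ℝ³`; with `a = c/(2 max θ₀)` and `U ≥ ‖u₀‖`, the transfer
`gaussMeasure u θ = (w ↦ u + √θ w)_* N(0, id)` and `‖u + √θ w‖² ≤ 2‖u‖² + 2θ‖w‖²` give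
`∫ e^{a‖v‖²} dN(u, θ id) ≤ K = e^{2aU²} ∫ e^{c‖w‖²} dN(0, id)`. [folklore] -/
theorem energyBudget_exists_lintegral_exp_gaussMeasure_le {θ₀ : T3 → ℝ} {u₀ : T3 → V3}
    (hθ : Continuous θ₀) (hu : Continuous u₀) (hθ0 : ∀ x, 0 < θ₀ x) :
    ∃ a : ℝ, 0 < a ∧ ∃ K : ℝ, 1 ≤ K ∧ ∀ x : T3,
      ∫⁻ v, ENNReal.ofReal (Real.exp (a * ‖v‖ ^ 2)) ∂gaussMeasure (u₀ x) (θ₀ x) ≤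
        ENNReal.ofReal K := by
  -- Fernique for the standard Gaussian on `ℝ³`
  obtain ⟨c, hc, hint⟩ := IsGaussian.exists_integrable_exp_sq (stdGaussian V3)
  -- extrema of the continuous profiles on the compact torus
  obtain ⟨xM, -, hxM⟩ := isCompact_univ.exists_isMaxOn univ_nonempty hθ.continuousOn
  obtain ⟨U, hU⟩ : ∃ U : ℝ, ∀ x, ‖u₀ x‖ ≤ U := by
    obtain ⟨B, hB⟩ := isCompact_univ.exists_bound_of_continuousOn hu.continuousOn
    exact ⟨B, fun x => hB x (mem_univ x)⟩
  have hmax : ∀ y, θ₀ y ≤ θ₀ xM := fun y => hxM (mem_univ y)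
  have hθM : 0 < θ₀ xM := hθ0 xM
  set a : ℝ := c / (2 * θ₀ xM) with ha_def
  have ha : 0 < a := div_pos hc (by positivity)
  refine ⟨a, ha, max (Real.exp (2 * a * U ^ 2) * ∫ w, Real.exp (c * ‖w‖ ^ 2) ∂stdGaussian V3) 1,
    le_max_right _ _, fun x => le_trans ?_ (ENNReal.ofReal_le_ofReal (le_max_left _ _))⟩
  -- the one-body transfer at `u = u₀ x`, `θ = θ₀ x`
  have haθ : 2 * a * θ₀ x ≤ c :=
    calc 2 * a * θ₀ x ≤ 2 * a * θ₀ xM := mul_le_mul_of_nonneg_left (hmax x) (by positivity)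
      _ = c := by rw [ha_def]; field_simp
  have hm : Measurable fun v : V3 => ENNReal.ofReal (Real.exp (a * ‖v‖ ^ 2)) :=
    (Real.measurable_exp.comp ((measurable_norm.pow_const 2).const_mul a)).ennreal_ofReal
  have hmc : Measurable fun w : V3 => ENNReal.ofReal (Real.exp (c * ‖w‖ ^ 2)) :=
    (Real.measurable_exp.comp ((measurable_norm.pow_const 2).const_mul c)).ennreal_ofReal
  have hU2 : ‖u₀ x‖ ^ 2 ≤ U ^ 2 := pow_le_pow_left₀ (norm_nonneg _) (hU x) 2
  -- `‖u + √θ w‖² ≤ 2‖u‖² + 2θ‖w‖²`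
  have hsq : ∀ w : V3, ‖u₀ x + Real.sqrt (θ₀ x) • w‖ ^ 2 ≤
      2 * ‖u₀ x‖ ^ 2 + 2 * θ₀ x * ‖w‖ ^ 2 := by
    intro w
    have h1 : ‖u₀ x + Real.sqrt (θ₀ x) • w‖ ≤ ‖u₀ x‖ + Real.sqrt (θ₀ x) * ‖w‖ := by
      calc ‖u₀ x + Real.sqrt (θ₀ x) • w‖ ≤ ‖u₀ x‖ + ‖Real.sqrt (θ₀ x) • w‖ := norm_add_le _ _
        _ = ‖u₀ x‖ + Real.sqrt (θ₀ x) * ‖w‖ := by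
            rw [norm_smul, Real.norm_of_nonneg (Real.sqrt_nonneg _)]
    have h2 : Real.sqrt (θ₀ x) ^ 2 = θ₀ x := Real.sq_sqrt (hθ0 x).le
    calc ‖u₀ x + Real.sqrt (θ₀ x) • w‖ ^ 2 ≤ (‖u₀ x‖ + Real.sqrt (θ₀ x) * ‖w‖) ^ 2 :=
          pow_le_pow_left₀ (norm_nonneg _) h1 2
      _ ≤ 2 * ‖u₀ x‖ ^ 2 + 2 * (Real.sqrt (θ₀ x) * ‖w‖) ^ 2 := by
          nlinarith [sq_nonneg (‖u₀ x‖ - Real.sqrt (θ₀ x) * ‖w‖)]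
      _ = 2 * ‖u₀ x‖ ^ 2 + 2 * θ₀ x * ‖w‖ ^ 2 := by rw [mul_pow, h2]; ring
  rw [gaussMeasure, lintegral_map hm (measurable_gaussShift (u₀ x) (θ₀ x))]
  calc ∫⁻ w, ENNReal.ofReal (Real.exp (a * ‖u₀ x + Real.sqrt (θ₀ x) • w‖ ^ 2)) ∂stdGaussian V3
      ≤ ∫⁻ w, ENNReal.ofReal (Real.exp (2 * a * U ^ 2)) *
          ENNReal.ofReal (Real.exp (c * ‖w‖ ^ 2)) ∂stdGaussian V3 := by
        refine lintegral_mono fun w => ?_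
        rw [← ENNReal.ofReal_mul (Real.exp_pos _).le, ← Real.exp_add]
        refine ENNReal.ofReal_le_ofReal (Real.exp_le_exp.2 ?_)
        have h1 : a * ‖u₀ x + Real.sqrt (θ₀ x) • w‖ ^ 2 ≤
            a * (2 * ‖u₀ x‖ ^ 2 + 2 * θ₀ x * ‖w‖ ^ 2) :=
          mul_le_mul_of_nonneg_left (hsq w) ha.le
        have h2 : 2 * a * θ₀ x * ‖w‖ ^ 2 ≤ c * ‖w‖ ^ 2 :=
          mul_le_mul_of_nonneg_right haθ (sq_nonneg _)
        nlinarith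
    _ = ENNReal.ofReal (Real.exp (2 * a * U ^ 2)) *
          ∫⁻ w, ENNReal.ofReal (Real.exp (c * ‖w‖ ^ 2)) ∂stdGaussian V3 :=
        lintegral_const_mul _ hmc
    _ = _ := by
        rw [← ofReal_integral_eq_lintegral_ofReal hint (ae_of_all _ fun w => (Real.exp_pos _).le),
          ← ENNReal.ofReal_mul (Real.exp_pos _).le]


/-! ## Pointwise domination by the energy budget -/

/-- The empirical exponential moment is dominated by the exponential of the total:
`(N+1)⁻¹ ∑ᵢ e^{a‖vᵢ‖²} ≤ e^{a ∑ⱼ ‖vⱼ‖²}` for `a ≥ 0` (each `‖vᵢ‖² ≤ ∑ⱼ ‖vⱼ‖²`, then the average of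
`N+1` numbers bounded by `e^{aS}` is at most `e^{aS}`). [folklore] -/
theorem expVelocityMoment_le_exp_sum {N : ℕ} {a : ℝ} (ha : 0 ≤ a)
    (w : Config (N + 1) (Fin 3) T3) :
    Literature.Barriers.AtomisticToContinuum.expVelocityMoment a w ≤
      ENNReal.ofReal (Real.exp (a * ∑ j, ‖(w j).2‖ ^ 2)) := by
  rw [Literature.Barriers.AtomisticToContinuum.expVelocityMoment_eq]
  refine ENNReal.ofReal_le_ofReal ?_
  have hle : ∀ i : Fin (N + 1), ‖(w i).2‖ ^ 2 ≤ ∑ j, ‖(w j).2‖ ^ 2 := fun i =>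
    Finset.single_le_sum (fun j _ => sq_nonneg ‖(w j).2‖) (Finset.mem_univ i)
  have hN : (0 : ℝ) < ((N + 1 : ℕ) : ℝ) := by exact_mod_cast Nat.succ_pos N
  calc ((N + 1 : ℕ) : ℝ)⁻¹ * ∑ i, Real.exp (a * ‖(w i).2‖ ^ 2)
      ≤ ((N + 1 : ℕ) : ℝ)⁻¹ * ∑ _i : Fin (N + 1), Real.exp (a * ∑ j, ‖(w j).2‖ ^ 2) := by
        gcongr with i
        exact hle i
    _ = Real.exp (a * ∑ j, ‖(w j).2‖ ^ 2) := by
        rw [Finset.sum_const, Finset.card_univ, Fintype.card_fin, nsmul_eq_mul, ← mul_assoc,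
          inv_mul_cancel₀ hN.ne', one_mul]

/-- **Pathwise energy budget along `Λ`.**  For `a ≥ 0`, every noise sequence, datum and time,
`(N+1)⁻¹ ∑ᵢ e^{a‖vᵢ(Λ_s)‖²} ≤ ∏ⱼ e^{a‖vⱼ(0)‖²}` in `ℝ≥0∞`: the previous lemma at `Λ_s(z, ξ)`, the
monotonicity of the kinetic energy along the Lambertian flow (`configEnergy_lambertFlow_le`) and
`e^{a∑} = ∏ e^{a·}`. [folklore] -/
theorem expVelocityMoment_lambertFlow_le_prod {σ : ℝ} {N : ℕ} {a : ℝ} (ha : 0 ≤ a)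
    (ξ : ℕ → EuclideanSpace ℝ (Fin 3)) (z : Config (N + 1) (Fin 3) T3) (s : ℝ) :
    Literature.Barriers.AtomisticToContinuum.expVelocityMoment a
        (lambertFlow (Torus.geometry (Fin 3)) (hsDiameter σ N) ξ z s) ≤
      ∏ j, ENNReal.ofReal (Real.exp (a * ‖(z j).2‖ ^ 2)) := by
  refine (expVelocityMoment_le_exp_sum ha _).trans ?_
  have hE : ∑ j, ‖(lambertFlow (Torus.geometry (Fin 3)) (hsDiameter σ N) ξ z s j).2‖ ^ 2 ≤
      ∑ j, ‖(z j).2‖ ^ 2 := by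
    have h := configEnergy_lambertFlow_le (G := Torus.geometry (Fin 3)) (ε := hsDiameter σ N) ξ z s
    simp only [configEnergy] at h
    linarith
  calc ENNReal.ofReal (Real.exp (a *
          ∑ j, ‖(lambertFlow (Torus.geometry (Fin 3)) (hsDiameter σ N) ξ z s j).2‖ ^ 2))
      ≤ ENNReal.ofReal (Real.exp (a * ∑ j, ‖(z j).2‖ ^ 2)) :=
        ENNReal.ofReal_le_ofReal (Real.exp_le_exp.2 (mul_le_mul_of_nonneg_left hE ha))
    _ = ∏ j, ENNReal.ofReal (Real.exp (a * ‖(z j).2‖ ^ 2)) := by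
        rw [Finset.mul_sum, Real.exp_sum, ENNReal.ofReal_prod_of_nonneg
          fun j _ => (Real.exp_pos _).le]

/-! ## The static product bound under the local Gibbs law -/

-- adapted from Theorems/OneFlightGossipEngineEnergyCurrentTailsLevelCensusStatics.lean
/-- **Product exponential moment under the local Gibbs law.**  If the one-body bound
`∫ e^{a‖v‖²} dN(u₀(x), θ₀(x) id) ≤ K` holds uniformly in `x ∈ 𝕋³`, then for `σ ≤ 1/2`, every `N`
and every flow `Φ`: `E_{λ_N} ∏ⱼ e^{a‖vⱼ‖²} ≤ K^{N+1}` — given the positions the velocities are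
INDEPENDENT Gaussians (`lintegral_localGibbsMeasure`; `velMeasure` is a product measure, Tonelli
`lintegral_fintype_prod_eq_prod'`; the position marginal has mass one,
`lintegral_posWeight_eq_one`). [folklore] -/
theorem lintegral_prod_exp_localGibbsLaw_le {a₀ θ₀ : T3 → ℝ} {u₀ : T3 → V3}
    (ha : Continuous a₀) (hθ : Continuous θ₀) (hu : Continuous u₀)
    (ha0 : ∀ x, 0 < a₀ x) (hθ0 : ∀ x, 0 < θ₀ x) {a : ℝ} {K : ℝ≥0∞}
    (hK : ∀ x : T3, ∫⁻ v, ENNReal.ofReal (Real.exp (a * ‖v‖ ^ 2)) ∂gaussMeasure (u₀ x) (θ₀ x) ≤ K)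
    {σ : ℝ} (hσ2 : σ ≤ 1 / 2) (N : ℕ)
    (Φ : HardSphereFlow (Torus.geometry (Fin 3)) (hsDiameter σ N) (N + 1)) :
    ∫⁻ z, ∏ j : Fin (N + 1), ENNReal.ofReal (Real.exp (a * ‖(z j).2‖ ^ 2))
      ∂(localGibbsLaw σ a₀ u₀ θ₀ N Φ) ≤ K ^ (N + 1) := by
  have ha0' : ∀ x, 0 ≤ a₀ x := fun x => (ha0 x).le
  haveI := isProbabilityMeasure_localGibbsMeasure ha hθ hu ha0 hθ0 hσ2 N
  have hg : Measurable fun w : V3 => ENNReal.ofReal (Real.exp (a * ‖w‖ ^ 2)) :=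
    (Real.measurable_exp.comp ((measurable_norm.pow_const 2).const_mul a)).ennreal_ofReal
  have hG : Measurable fun z : Config (N + 1) (Fin 3) T3 =>
      ∏ j : Fin (N + 1), ENNReal.ofReal (Real.exp (a * ‖(z j).2‖ ^ 2)) :=
    Finset.measurable_prod _ fun j _ => hg.comp (measurable_pi_apply j).snd
  have hZm : Measurable fun x : Fin (N + 1) → T3 => ENNReal.ofReal
      ((canonicalPartition (Torus.geometry (Fin 3)) (hsDiameter σ N) (N + 1)
        (localGibbsProfile a₀ u₀ θ₀))⁻¹ * posWeight a₀ (hsDiameter σ N) (N + 1) x) :=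
    ((measurable_posWeight ha _ _).const_mul _).ennreal_ofReal
  have hB : ∀ x : Fin (N + 1) → T3,
      ∫⁻ v, ∏ j : Fin (N + 1), ENNReal.ofReal (Real.exp (a * ‖(zipConfig (x, v) j).2‖ ^ 2))
        ∂velMeasure u₀ θ₀ x ≤ K ^ (N + 1) := by
    intro x
    simp only [zipConfig_apply]
    unfold velMeasure
    rw [lintegral_fintype_prod_eq_prod' (fun j => gaussMeasure (u₀ (x j)) (θ₀ (x j)))
      (f := fun _ w => ENNReal.ofReal (Real.exp (a * ‖w‖ ^ 2))) fun _ => hg]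
    calc ∏ j : Fin (N + 1), ∫⁻ w, ENNReal.ofReal (Real.exp (a * ‖w‖ ^ 2))
          ∂gaussMeasure (u₀ (x j)) (θ₀ (x j))
        ≤ ∏ _j : Fin (N + 1), K := Finset.prod_le_prod' fun j _ => hK (x j)
      _ = K ^ (N + 1) := by rw [Finset.prod_const, Finset.card_univ, Fintype.card_fin]
  rw [localGibbsLaw_eq, lintegral_localGibbsMeasure ha hθ hu ha0' hθ0 σ N hG]
  refine (lintegral_mono fun x => mul_le_mul_right (hB x) _).trans_eq ?_
  rw [lintegral_mul_const _ hZm, lintegral_posWeight_eq_one ha hθ hu ha0' hθ0 σ N, one_mul]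

/-! ## The sub-goal -/

/-- **`TailsLambda` at fixed `N`: the energy-budget bound.**  For continuous profiles
`a₀, θ₀ > 0`, `u₀` there are `a > 0` and `K ≥ 1` such that for every `σ ≤ 1/2`, every `N`, every
flow `Φ` and every time `s`, the expected empirical exponential velocity moment of the Lambertian
flow `Λ_s` under `λ_N ⊗ γ^ℕ` is at most `K^{N+1}`: pathwise energy budget
(`expVelocityMoment_lambertFlow_le_prod`), `lintegral_prod_le` with `γ^ℕ(univ) = 1`, and the
static product bound (`lintegral_prod_exp_localGibbsLaw_le`) with the uniform one-body constant of
`energyBudget_exists_lintegral_exp_gaussMeasure_le`.  The expectation in `TailsLambda` is thus finite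
at each `N` for ALL times; its open content is the `N`-uniform constant. [folklore] -/
theorem lambertFlow_expVelocityMoment_le_pow :
    ∀ {a₀ θ₀ : T3 → ℝ} {u₀ : T3 → V3}, Continuous a₀ → Continuous θ₀ → Continuous u₀ →
      (∀ x, 0 < a₀ x) → (∀ x, 0 < θ₀ x) →
      ∃ a : ℝ, 0 < a ∧ ∃ K : ℝ, 1 ≤ K ∧ ∀ {σ : ℝ}, σ ≤ 1 / 2 → ∀ (N : ℕ)
        (Φ : HardSphereFlow (Torus.geometry (Fin 3)) (hsDiameter σ N) (N + 1)) (s : ℝ),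
        ∫⁻ p, Literature.Barriers.AtomisticToContinuum.expVelocityMoment a
            (lambertFlow (Torus.geometry (Fin 3)) (hsDiameter σ N) p.2 p.1 s)
          ∂((localGibbsLaw σ a₀ u₀ θ₀ N Φ).prod (lambertNoise (Fin 3))) ≤
          ENNReal.ofReal (K ^ (N + 1)) := by
  intro a₀ θ₀ u₀ ha hθ hu ha0 hθ0
  obtain ⟨a, ha_pos, K, hK1, hK⟩ := energyBudget_exists_lintegral_exp_gaussMeasure_le hθ hu hθ0
  refine ⟨a, ha_pos, K, hK1, fun {σ} hσ N Φ s => ?_⟩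
  rw [ENNReal.ofReal_pow (zero_le_one.trans hK1)]
  calc ∫⁻ p, Literature.Barriers.AtomisticToContinuum.expVelocityMoment a
          (lambertFlow (Torus.geometry (Fin 3)) (hsDiameter σ N) p.2 p.1 s)
        ∂((localGibbsLaw σ a₀ u₀ θ₀ N Φ).prod (lambertNoise (Fin 3)))
      ≤ ∫⁻ z, ∫⁻ ξ, Literature.Barriers.AtomisticToContinuum.expVelocityMoment a
          (lambertFlow (Torus.geometry (Fin 3)) (hsDiameter σ N) ξ z s)
            ∂(lambertNoise (Fin 3)) ∂(localGibbsLaw σ a₀ u₀ θ₀ N Φ) := lintegral_prod_le _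
    _ ≤ ∫⁻ z, ∫⁻ _ξ, ∏ j, ENNReal.ofReal (Real.exp (a * ‖(z j).2‖ ^ 2))
            ∂(lambertNoise (Fin 3)) ∂(localGibbsLaw σ a₀ u₀ θ₀ N Φ) :=
        lintegral_mono fun z => lintegral_mono fun ξ =>
          expVelocityMoment_lambertFlow_le_prod ha_pos.le ξ z s
    _ = ∫⁻ z, ∏ j, ENNReal.ofReal (Real.exp (a * ‖(z j).2‖ ^ 2))
            ∂(localGibbsLaw σ a₀ u₀ θ₀ N Φ) := by
        simp only [lintegral_const, measure_univ, mul_one]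
    _ ≤ ENNReal.ofReal K ^ (N + 1) :=
        lintegral_prod_exp_localGibbsLaw_le ha hθ hu ha0 hθ0 hK hσ N Φ

end Summit.AtomisticToContinuum.HydrodynamicLimit.Theorems.LambertianContactSwapLambertianEulerEnergyBudget

end
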